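import Mathlib
import HarnessLib
import Literature.MathematicalPhysics.KineticTheory.HardSphereEulerProofs
import Literature.Probability.Entropy.StrongDataProcessingProofs
import Summits.AtomisticToContinuum.HydrodynamicLimit.Theorems.JParityClosureOddContactSymmetryGibbsInvariance
import Summits.AtomisticToContinuum.HydrodynamicLimit.Theorems.LambertianContactSwapLambertianEulerEntropyBudget

/-!
# Stub `stub_liouvilleEntropyTransfer` of the birth skeleton of the crux `MeanSecondLaw`
# (`AnnealedZeroHorizon.MeanSecondLaw`, stmt-AtomisticToContinuum-9257)

Helper file (`--supports`) for the registered line (birth skeleton) of the crux: the DYNAMIC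
(Liouville) input of the annealed coarse-grained second law for deterministic hard spheres.

For the local Gibbs law `P₀ = localGibbsLaw σ a₀ u₀ θ₀ N Φ` (`= localGibbsMeasure σ a₀ u₀ θ₀ N`
for every flow `Φ`, `localGibbsLaw_eq`) and the HOMOGENEOUS hard-sphere Gibbs measure
`G_N = localGibbsMeasure σ 1 0 θr N` (uniform positions on the hard-sphere domain, Maxwellian
velocities at temperature `θr`), the law at time `t`, `(Φ_t)_* P₀`, satisfies
`H((Φ_t)_* P₀ | G_N) ≤ H(P₀ | G_N)`.

Proof.  `G_N` is invariant under every flow map `Φ_t` (Liouville's theorem + conservation of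
kinetic energy and momentum + invariance of the hard-core constraint on the good set; in tree as
`map_flow_localGibbsLaw_const`), so `H((Φ_t)_* P₀ | G_N) = H((Φ_t)_* P₀ | (Φ_t)_* G_N)`, and the
data-processing inequality for the deterministic Markov kernel of the measurable map `Φ_t`
(`Literature.Probability.Entropy.klDiv_comp_le`, `Measure.deterministic_comp_eq_map`) bounds the
latter by `H(P₀ | G_N)`.  Both measures are finite for EVERY reduced diameter `σ` (total mass
`Z⁻¹ Z ≤ 1`, `localGibbsMeasure_univ`), and the phase space `(𝕋³ × ℝ³)^{N+1}` is standard Borel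
(`standardBorelSpace_config`).  The hypotheses `0 < σ` and `0 ≤ t` of the registered signature
are not used.

References: H. Spohn, *Large Scale Dynamics of Interacting Particles* (1991), Part I §2.3
(equilibrium measures are invariant under the dynamics); data-processing inequality for the
Kullback–Leibler divergence (folklore).
-/

namespace Summit.AtomisticToContinuum.HydrodynamicLimit.Theorems.MeanSecondLawBirth

open MeasureTheory Filter Set Topology
open scoped ENNReal
open Literature.MathematicalPhysics.KineticTheory

/-- The local Gibbs measure is a finite measure for continuous profiles `a₀ ≥ 0`, `θ₀ > 0`, `u₀`,
EVERY reduced diameter `σ` and every particle number: its total mass is `Z⁻¹ · Z ≤ 1`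
(`localGibbsMeasure_univ`; `= 1` if the configurational partition function `Z` is positive, `= 0`
if it vanishes). [folklore] -/
theorem isFiniteMeasure_localGibbsMeasure_of_continuous {a₀ θ₀ : T3 → ℝ} {u₀ : T3 → V3}
    (ha : Continuous a₀) (hθ : Continuous θ₀) (hu : Continuous u₀) (ha0 : ∀ x, 0 ≤ a₀ x)
    (hθ0 : ∀ x, 0 < θ₀ x) (σ : ℝ) (N : ℕ) :
    IsFiniteMeasure (localGibbsMeasure σ a₀ u₀ θ₀ N) := by
  refine ⟨?_⟩
  rw [localGibbsMeasure_univ ha hθ hu ha0 hθ0 σ N]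
  exact ENNReal.mul_lt_top ENNReal.ofReal_lt_top ENNReal.ofReal_lt_top

/-- **Data processing against an invariant reference law**: for finite measures `P`, `R` on a
standard Borel space and a measurable map `f` with `f_* R = R`,
`KL(f_* P ‖ R) ≤ KL(P ‖ R)` — the data-processing inequality
`Literature.Probability.Entropy.klDiv_comp_le` for the deterministic Markov kernel of `f`
(`Measure.deterministic_comp_eq_map`). [folklore] -/
theorem klDiv_map_le_of_map_eq {α : Type*} [MeasurableSpace α] [StandardBorelSpace α]
    [Nonempty α] (P R : Measure α) [IsFiniteMeasure P] [IsFiniteMeasure R] {f : α → α}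
    (hf : Measurable f) (hR : R.map f = R) :
    InformationTheory.klDiv (P.map f) R ≤ InformationTheory.klDiv P R := by
  have h := Literature.Probability.Entropy.klDiv_comp_le P R
    (ProbabilityTheory.Kernel.deterministic f hf)
  rwa [Measure.deterministic_comp_eq_map, Measure.deterministic_comp_eq_map, hR] at h

/-- **Registered stub `stub_liouvilleEntropyTransfer`** (Liouville entropy transfer; birth
skeleton of crux stmt-AtomisticToContinuum-9257, `AnnealedZeroHorizon.MeanSecondLaw`): for the
local Gibbs law `P₀ = localGibbsLaw σ a₀ u₀ θ₀ N Φ` and the homogeneous hard-sphere Gibbs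
measure `G_N = localGibbsMeasure σ 1 0 θr N`, `H((Φ_t)_* P₀ | G_N) ≤ H(P₀ | G_N)`.
Proof: `(Φ_t)_* G_N = G_N` (`map_flow_localGibbsLaw_const`: Liouville + energy/momentum
conservation) and the data-processing inequality for the measurable map `Φ_t`
(`klDiv_map_le_of_map_eq`). [folklore] -/
theorem stub_liouvilleEntropyTransfer :
    ∀ σ : ℝ, 0 < σ → ∀ θr : ℝ, 0 < θr →
    ∀ (a₀ θ₀ : T3 → ℝ) (u₀ : T3 → V3), Continuous a₀ → Continuous θ₀ → Continuous u₀ →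
      (∀ x, 0 < a₀ x) → (∀ x, 0 < θ₀ x) →
    ∀ (N : ℕ) (Φ : Literature.Analysis.FluidPDE.HardSphereFlow
        (Literature.Analysis.FluidPDE.Torus.geometry (Fin 3)) (hsDiameter σ N) (N + 1)) (t : ℝ), 0 ≤ t →
      InformationTheory.klDiv ((localGibbsLaw σ a₀ u₀ θ₀ N Φ).map (Φ.flow t))
          (localGibbsMeasure σ (fun _ => 1) (fun _ => 0) (fun _ => θr) N) ≤
        InformationTheory.klDiv (localGibbsMeasure σ a₀ u₀ θ₀ N)
          (localGibbsMeasure σ (fun _ => 1) (fun _ => 0) (fun _ => θr) N) := by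
  intro σ _hσ θr hθr a₀ θ₀ u₀ ha hθ hu ha0 hθ0 N Φ t _ht
  haveI : StandardBorelSpace (Literature.Analysis.FluidPDE.Config (N + 1) (Fin 3) T3) :=
    LambertianContactSwapLambertianEulerEntropyBudget.standardBorelSpace_config (N + 1)
  haveI : IsFiniteMeasure (localGibbsMeasure σ a₀ u₀ θ₀ N) :=
    isFiniteMeasure_localGibbsMeasure_of_continuous ha hθ hu (fun x => (ha0 x).le) hθ0 σ N
  haveI : IsFiniteMeasure (localGibbsMeasure σ (fun _ => 1) (fun _ => 0) (fun _ => θr) N) :=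
    isFiniteMeasure_localGibbsMeasure_of_continuous continuous_const continuous_const
      continuous_const (fun _ => zero_le_one) (fun _ => hθr) σ N
  -- invariance of the homogeneous Gibbs measure under the flow map `Φ_t`
  have hG : (localGibbsMeasure σ (fun _ => 1) (fun _ => 0) (fun _ => θr) N).map (Φ.flow t) =
      localGibbsMeasure σ (fun _ => 1) (fun _ => 0) (fun _ => θr) N := by
    have h := map_flow_localGibbsLaw_const σ 1 θr 0 N Φ t
    rwa [localGibbsLaw_eq] at h
  rw [localGibbsLaw_eq]
  exact klDiv_map_le_of_map_eq _ _ (Φ.measurable_flow t) hG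

end Summit.AtomisticToContinuum.HydrodynamicLimit.Theorems.MeanSecondLawBirth
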